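import Summits.CriticalPhenomena.SAWScalingLimit.Theorems.SAWRenewalTightnessRoomEntropyDefs
import Literature.Probability.RandomPlanarGeometry.LatticeSlitIncrements
import Literature.Probability.RandomPlanarGeometry.LoewnerChain
import HarnessLib

/-!
# Objects of the lattice-to-continuum passage of the line `room-entropy-wright-fisher`
(crux `SubseqIdentification`, stmt-CriticalPhenomena-0783; lead prover, crux protocol; skeleton
`Summits/CriticalPhenomena/SAWScalingLimit/Cruxes/SubseqIdentification/Lines/room_entropy_wright_fisher.lean`,
reshape r6 of the continuation seat)

Companion of `Theorems/SAWRenewalTightnessRoomEntropyDefs.lean` (the room–entropy vocabulary: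
`roomObs`, `roomStop`, `roomObsStopped`; `slitGraph`, `roomAt`, `condRoom`, `sideAngle`, …). The
transfer stub of the line (`RoomLawSlit → RoomMartingaleLimit`: from the lattice room–entropy law to the
martingale property of the continuum observable under a describable subsequential limit) is proved along
the tree's identification chain for lattice interfaces
(`Loewner.integral_cylinder_eq_zero_of_tendstoInDistribution`, `ObservableLimitPassage.lean`;
`LatticeSlit.pastHull / capTime / drivingValue`, `LatticeSlitIncrements.lean`). That chain needs a
few more OBJECTS, defined here verbatim as the registered stub signatures use them — no statement of
the line is asserted in this file:

* `capTimeOf w = (Im w)²/16`, `capLevelOf w = ⌈(Im w)²/16⌉₊` and the **time-capped room–entropy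
  observable** `roomObsCap W w u = roomObsStopped W w (capLevelOf w) (u ∧ capTimeOf w)`: up to the
  deterministic time `(Im w)²/16` EVERY continuous driver keeps the point `w` at height `≥ (√3/2) Im w`
  (`(Im z_t)² ≥ (Im w)² − 4t`, `Loewner.im_sq_sub_le_im_map_sq`), so no path-dependent stopping is
  needed on the lattice side (this is the rôle of CDHKS's `T(iy) = y²/9` for the Ising observable,
  `Loewner.cdhksTime`); the far field of the endgame only ever looks at bounded times from far points,
  where the cap is inactive;
* the **hull functionals** `hullDerivRatio K w = Im w · |g_K'(w)| / Im g_K(w)`,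
  `hullSchrammObs K ξ w = (1 + Re Z/|Z|)/2`, `Z = g_K(w) − ξ`, and
  `hullRoomObs K ξ w = log hullDerivRatio + 3 H(hullSchrammObs)` of a half-plane hull `K` with
  hydrodynamic map `g_K = hydroFun K` and a real base point `ξ` (for the hull of a Loewner chain at time
  `t` and `ξ = W_t` these are `Loewner.derivRatio`, `Loewner.schrammObs` and `roomObs` at time `t`);
* `prefixAt γ n` — the lattice past `γ[0, n]` of a self-avoiding walk as a walk (`takeUntil` of the
  `n`-th vertex; the whole walk for `n ≥ |γ|`);
* `DrivesPast φ γ V` — **the continuous function `V` drives the pasts of `γ` read through `φ`**: at the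
  capacity time `t_η` of every prefix `η` the Loewner chain of `V` has hull `K_η ∩ ℍ`
  (`LatticeSlit.pastHull`, the filled pull-back of the polyline attached to `0` by its stem), Loewner map
  `g_{K_η}` off `K_η`, and driving value `ξ_η` (`LatticeSlit.drivingValue`), and `V` is frozen after
  the capacity time of the whole walk; `latticeDriver φ γ` — a choice of such a `V` (junk `0` if none;
  the line's stub `stub_sawLatticeDrivers` asserts existence for all small meshes, prefix-consistency and
  convergence in law to `drivingFunction φ` under describable subsequential limits);
* `roomDoob D δ a b z γ n = (π/2)·[G_{Ω_δ}(z,z) − E_δ[terminal room ∣ γ[0,n]]]` — the exact Doob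
  martingale of the terminal room deficit along the exploration (`condRoom` of the prefix).

Sources: the line card `Lines/room-entropy-wright-fisher.md`; G. F. Lawler, *Conformally Invariant
Processes in the Plane* (2005) §3.4, §4.1 (hulls, `g_A`, capacity parametrisation, driving function);
D. Chelkak, H. Duminil-Copin, C. Hongler, A. Kemppainen, S. Smirnov, C. R. Math. 352 (2014) §3 (the
time-limited observable and the passage of discrete martingales to the limit).
-/

noncomputable section

open MeasureTheory Filter Topology Set
open scoped NNReal ENNReal Classical BigOperators
open Literature.Probability.LatticeModels
open Literature.Probability.RandomPlanarGeometry
open UpperHalfPlane (upperHalfPlaneSet)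

namespace Summit.CriticalPhenomena.SAWScalingLimit.Theorems.SubseqIdentification.RoomEntropy

/-! ## The time-capped observable -/

/-- The **cap time** `(Im w)²/16` of the point `w`: before it, every chordal Loewner flow keeps `w` at
height `≥ (√3/2)·Im w` (`(Im z_t)² ≥ (Im w)² − 4t`). [folklore] -/
def capTimeOf (w : ℂ) : ℝ≥0 :=
  Real.toNNReal (w.im ^ 2 / 16)

/-- The **cap level** `⌈(Im w)²/16⌉₊`: a room-stop level `m` with `m + 1 ≥ capTimeOf w` and
`Im w/(m+1) ≤ Im w/2`, so that the room stop `τ^{w,m}` cannot occur before the cap time. [folklore] -/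
def capLevelOf (w : ℂ) : ℕ :=
  ⌈w.im ^ 2 / 16⌉₊

/-- The **time-capped room–entropy observable** `N^{w}_u = N_{u ∧ (Im w)²/16}(w)`, written through the
stopped observable at the cap level (to which it is equal for continuous drivers, the room stop at that
level being later than the cap time) so that the measurability, boundedness and continuity lemmas of the
stopped observable apply verbatim. [folklore] -/
def roomObsCap (W : ℝ≥0 → ℝ) (w : ℂ) (u : ℝ≥0) : ℝ :=
  roomObsStopped W w (capLevelOf w) (min u (capTimeOf w))

/-! ## Hull functionals -/

/-- `ψ^K(w) = Im w · |g_K'(w)| / Im g_K(w)` — the ratio of the conformal radii of `ℍ` and `ℍ ∖ K` seen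
from `w` (`g_K = hydroFun K`, the Schwarz-reflected hydrodynamic map; Rohde–Schramm's `ψ_t` when `K` is
the hull of a Loewner chain at time `t`, `Loewner.derivRatio`). [cite: Lawler2005, §3.4 Prop. 3.36] -/
def hullDerivRatio (K : Set ℂ) (w : ℂ) : ℝ :=
  w.im * ‖deriv (hydroFun K) w‖ / (hydroFun K w).im

/-- `S^K(ξ, w) = (1 + Re Z/|Z|)/2`, `Z = g_K(w) − ξ` — Schramm's observable of the hull `K` seen from
`w` with base point `ξ ∈ ℝ` (`Loewner.schrammObs` when `K` is a Loewner hull and `ξ` the driving value).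
[cite: Lawler2005, §4.1 Lemma 4.2] -/
def hullSchrammObs (K : Set ℂ) (ξ : ℝ) (w : ℂ) : ℝ :=
  (1 + (hydroFun K w - ξ).re / ‖hydroFun K w - ξ‖) / 2

/-- `N^K(ξ, w) = log ψ^K(w) + 3 H(S^K(ξ, w))` — the room–entropy combination of a hull (`roomObs` when
`K` is a Loewner hull and `ξ` the driving value). [folklore] -/
def hullRoomObs (K : Set ℂ) (ξ : ℝ) (w : ℂ) : ℝ :=
  Real.log (hullDerivRatio K w) + 3 * Real.binEntropy (hullSchrammObs K ξ w)

/-! ## Pasts of a lattice walk and their drivers -/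

/-- The **past `γ[0, n]`** of a self-avoiding walk of `Ω_δ`: the initial segment up to its `n`-th vertex
(`SimpleGraph.Walk.takeUntil` of `getVert n`; the whole walk when `n ≥ |γ|`). [folklore] -/
def prefixAt {Ω : Set ℂ} {δ : ℝ} {a b : Site 2} (γ : SAW.DomainSAW Ω δ a b) (n : ℕ) :
    (discreteDomainGraph Ω δ).Walk a (γ.walk.getVert n) :=
  γ.walk.takeUntil (γ.walk.getVert n) (γ.walk.getVert_mem_support n)

/-- **`V` drives the pasts of `γ` through `φ`**: `V` is continuous; at the capacity time
`t_n = LatticeSlit.capTime φ γ[0,n]` of every past the chordal Loewner chain of `V` has swallowed exactly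
`K_n ∩ ℍ` (`K_n = LatticeSlit.pastHull φ γ[0,n]`), its map is the hydrodynamic map `g_{K_n}` off `K_n`
and its value is the driving value `ξ_n = LatticeSlit.drivingValue φ γ[0,n]` (Lawler's `U_t` of the
growing slit with its stem); and `V` is constant after the capacity time of the whole walk.
[cite: Lawler2005, §4.1 (Prop. 4.4, Lemma 4.2)] -/
def DrivesPast {D : DobrushinDomain} (φ : ConformalEquiv upperHalfPlaneSet D.carrier) {δ : ℝ}
    {a b : Site 2} (γ : SAW.DomainSAW D.carrier δ a b) (V : ℝ≥0 → ℝ) : Prop :=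
  Continuous V ∧
  (∀ n : ℕ,
    V (LatticeSlit.capTime φ (prefixAt γ n)).toNNReal = LatticeSlit.drivingValue φ (prefixAt γ n) ∧
    Loewner.hull V (LatticeSlit.capTime φ (prefixAt γ n)).toNNReal =
      LatticeSlit.pastHull φ (prefixAt γ n) ∩ upperHalfPlaneSet ∧
    EqOn (Loewner.map V (LatticeSlit.capTime φ (prefixAt γ n)).toNNReal)
      (hydroFun (LatticeSlit.pastHull φ (prefixAt γ n)))
      (upperHalfPlaneSet \ LatticeSlit.pastHull φ (prefixAt γ n))) ∧
  ∀ u : ℝ≥0, LatticeSlit.capTime φ γ.walk ≤ u → V u = V (LatticeSlit.capTime φ γ.walk).toNNReal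

/-- **The lattice driving function** of the walk `γ` through `φ`: a continuous function driving its
pasts when there is one (`DrivesPast`), the junk constant `0` otherwise. (Kennedy (2008) §3: "the driving
function of the lattice curve"; the line's stub `stub_sawLatticeDrivers` asserts existence for all small
meshes.) [cite: Lawler2005, §4.1] -/
def latticeDriver {D : DobrushinDomain} (φ : ConformalEquiv upperHalfPlaneSet D.carrier) {δ : ℝ}
    {a b : Site 2} (γ : SAW.DomainSAW D.carrier δ a b) : ℝ≥0 → ℝ :=
  if h : ∃ V, DrivesPast φ γ V then h.choose else fun _ => 0

/-- The **Doob martingale of the terminal room deficit** along the exploration: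
`F_n(γ) = (π/2)·[G_{Ω_δ}(z, z) − E_δ[G_{Ω_δ∖γ'}(z, z) ∣ γ' ⊒ γ[0,n]]]` (`roomAt` with no slit minus the
conditional expected terminal room `condRoom` of the past). [folklore] -/
def roomDoob (D : DobrushinDomain) (δ : ℝ) (a b z : Site 2) (γ : SAW.DomainSAW D.carrier δ a b)
    (n : ℕ) : ℝ :=
  Real.pi / 2 * (roomAt D.carrier δ ∅ z - condRoom D.carrier δ a b z (prefixAt γ n))

/-! ## Trivial API (sanity of the vocabulary) -/

/-- The lattice driving function is continuous (also in the junk case). [folklore] -/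
theorem continuous_latticeDriver {D : DobrushinDomain} (φ : ConformalEquiv upperHalfPlaneSet D.carrier)
    {δ : ℝ} {a b : Site 2} (γ : SAW.DomainSAW D.carrier δ a b) : Continuous (latticeDriver φ γ) := by
  unfold latticeDriver
  split_ifs with h
  · exact h.choose_spec.1
  · exact continuous_const

/-- A function driving the pasts of `γ` is, by definition, continuous. [folklore] -/
theorem DrivesPast.continuous {D : DobrushinDomain} {φ : ConformalEquiv upperHalfPlaneSet D.carrier}
    {δ : ℝ} {a b : Site 2} {γ : SAW.DomainSAW D.carrier δ a b} {V : ℝ≥0 → ℝ}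
    (h : DrivesPast φ γ V) : Continuous V :=
  h.1

/-- The cap level is positive for a point of the upper half-plane. [folklore] -/
theorem capLevelOf_pos {w : ℂ} (hw : 0 < w.im) : 0 < capLevelOf w :=
  Nat.ceil_pos.2 (by positivity)

end Summit.CriticalPhenomena.SAWScalingLimit.Theorems.SubseqIdentification.RoomEntropy

end
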